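import Summits.FinalStateConjecture.FinalStateConjecture.Theorems.BartnikGapSettlingBondiBartnikRigidityStationaryKerrCollarRouteOriented
import Summits.FinalStateConjecture.FinalStateConjecture.Theorems.BartnikGapSettlingBondiBartnikRigidityDirectMethodLeafDefs
import Literature.Geometry.Lorentzian.SpacetimeLocalConvergence
import HarnessLib

/-!
# K3 `stub_compactnessToKerrInterior` — the compactness / semicontinuity / transfer package, TYPED
# (oriented, rest-frame form) — line `direct-method-on-the-cone` (crux `BondiBartnikRigidity`,
# stmt-FinalStateConjecture-10807), worker K3 of lead c3 (re-typing of lead a2's wave-1 package)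

The registered K3 reads the crux's `∃ k' ∀ Λ < 1 ∃ δ γ ∀ instances` as "failure ⇒ a minimising
sequence with a priori bounds": a failing family at fixed `(χ, m₀, k', Λ)` with `δₙ, γₙ → 0` is a
sequence of NEAR-MINIMISING INSTANCES (`K3Route.NearMinimisingInstance`: an MGHD of admissible data, a
pinned sound `(Λ, k')`-leaf `S ∋ p`, ONE rest-frame `δ`-Kerr thick collar through `p`, future/time
oriented, core with a cut energy and Bondi–Bartnik gap `≤ γ`); the direct method extracts a limit in the
LIMIT CATEGORY (`K3Route.ExactCollarInstance`: a maximal vacuum development of arbitrary smooth data with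
an EXACT, ORIENTED thick Kerr collar on its Cauchy slice) tied to a subsequence by a SHADOW
(`K3Route.Shadow`: pointed `Cᵏ_loc` subconvergence `Spacetime.LocalSubconvergence` carrying core onto
core, converging hole parameters), shows it is an exact minimiser with a competitor (semicontinuity),
applies `ExactMinimiserKerrnessOriented` (= K1 ∘ K2, the other stubs) and transfers an exact Kerr box back.
The four inputs are unprinted as packaged and are typed here as route-posited statements (nothing is
asserted; each docstring carries statement, role, sources and its junk audit):

* (F1') `K3Route.LeafCompactness'` — every near-minimising sequence has a limit exact-collar instance
  shadowing a subsequence, whose core HAS a cut energy and HAS a competitor mass (all EXISTENCE claims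
  about the limit live here);
* (F2) `K3Route.CutEnergyLSC` — lower semicontinuity of the cut energy along a shadow;
* (F3) `K3Route.CompetitorRealisation` — upper semicontinuity of the infimum (competitor masses of the
  limit core are asymptotically realised by competitor masses of the approximants);
* (F4) `K3Route.BoxTransfer` — exact Kerr boxes of every size in the limit's `J⁺(C∞)` transfer to
  `(ε, k₁)`-boxes in `J⁺(Cₙ)` for large `n`.

Changes against lead a2's wave-1 typing (`Cruxes/…/Lines/direct_method_on_the_cone_K3.lean`) found by the
junk audit (worker report attached to the item by the lead): (a) instances and limit instances carry
the orientation clauses `K2Route.CollarFutureOriented`/`CollarTimeOriented` and the rest frame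
`(mo 0).1 = 1` (the unoriented block is refuted by time reversal); (b) the shadow is based at FREE base
points, not at the probe points `pₙ` — the hypotheses let `pₙ` drift to the collar's inner edge `r → M⁺`,
where no point of a limit collar can sit (curvature invariants at the base point), so the based form is
unproducible whenever instances exist; (c) "the limit core has a cut energy / a competitor mass" moved
from (F2)/(F3) into (F1'): a shadow does not pin the limit to be the FULL limit (the development of the
limit data near the slab alone — spatially bounded, no null infinity — shadows the same sequences), so
existence claims quantified over all shadows are refutable by small limits; (F2)–(F4) are now pure
semicontinuity/transfer statements; (d) (F4) is fed ALL exact boxes of the limit (the full conclusion of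
`ExactMinimiserKerrnessOriented`), which gives it its causal margin.  Also here: the soft package as ONE
statement `K3Route.NearMinimiserShadowing` and the registered K3 from it and
`ExactMinimiserKerrnessOriented` by pure logic (`stub_compactnessToKerrInterior_of_shadowing`, the anchor
of this file); the checked reduction to (F1')–(F4) is `…CompactnessToKerrInteriorReduction.lean`.

References: Ringström 2009, Ch. 16 (Cauchy stability) [RingstromCauchyProblem2009]; Petersen 2006,
Ch. 10 §3.2 (pointed convergence) [Petersen2006]; Christodoulou–Klainerman 1993, Ch. 17 (Hawking/Bondi
mass) [ChristodoulouKlainerman1993PMS41]; Czimek–Rodnianski arXiv:2210.09663 (characteristic gluing)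
[CzimekRodnianski2022]; Kehle–Unger 2024 (event-horizon gluing) [KehleUnger2024EventHorizonGluing];
Huang–Lee arXiv:2007.00593, Def. 7.8 [HuangLee2020]; Dafermos–Luk 2017, §1 [DafermosLuk2017].
-/

noncomputable section

-- D-0017: single-problem summit, `Summit.<S>.<S>.…` by design (cf. lakefile `weak.linter.dupNamespace`).
set_option linter.dupNamespace false
-- instance search through the nested operator types of the Kerr chart facts
set_option maxSynthPendingDepth 3

open Set Filter Function Topology TopologicalSpace
open Literature.Geometry.Lorentzian
open scoped Manifold ContDiff Topology ENNReal

namespace Summit.FinalStateConjecture.FinalStateConjecture.Theorems.BondiBartnikRigidity.DirectMethod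

namespace K3Route

/-! ### Near-minimising instances, limit instances, shadows -/

/-- A **near-minimising instance** of K3 at margin/window `(χ, m₀)`, regularity `k'`, leaf
tolerance `Λ`, collar closeness `δ` and gap `γ`: EXACTLY the data and hypotheses over which the
registered K3 quantifies, bundled (so that sequences of instances are indexed by `ℕ`) — an MGHD
`𝒟` of admissible data on `X`, one hole `(M, a)` in the window, a pinned sound `(Λ, k')`-leaf
`S ∋ p`, `p` in the thick collar of the REST-FRAME chart `Φ₀` (`(mo 0).1 = 1`), the thick-collar
block `NearKerrCollarCore k' δ γ` (core with a cut energy and Bondi–Bartnik gap `≤ γ`) and the two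
orientation clauses of the collar chart. [folklore] -/
structure NearMinimisingInstance (χ m₀ : ℝ) (k' : ℕ) (Λ δ : ℝ≥0∞) (γ : ℝ) : Type 1 where
  /-- the data manifold -/ X : Type
  /-- its topology -/ [topologicalSpace : TopologicalSpace X]
  /-- its charts -/ [chartedSpace : ChartedSpace E3 X]
  /-- smoothness -/ [isManifold : IsManifold (𝓡 3) ∞ X]
  /-- Hausdorff -/ [t2Space : T2Space X]
  /-- second countable -/ [secondCountableTopology : SecondCountableTopology X]
  /-- connected -/ [connectedSpace : ConnectedSpace X]
  /-- the admissible datum -/ D : InitialDataSet (𝓡 3) X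
  /-- admissibility -/ mem_admissibleVacuumData : D ∈ admissibleVacuumData X
  /-- its maximal vacuum Cauchy development -/ 𝒟 : VacuumCauchyDevelopment D
  /-- mass of the hole -/ M : Fin 1 → ℝ
  /-- spin of the hole -/ a : Fin 1 → ℝ
  /-- the hypothesis leaf -/ S : Set 𝒟.carrier
  /-- the probe point -/ p : 𝒟.carrier
  /-- the motion of the collar chart -/ mo : Fin 1 → lorentzGroup × E4
  /-- the background of the collar chart -/ B : Fin 1 → ModelBackground
  /-- the collar chart -/ Φ : ∀ i, (B i).domain → 𝒟.carrier
  /-- maximality -/ isMaximal : 𝒟.IsMaximal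
  /-- the mass window and the margin -/ window : ∀ i, m₀ ≤ M i ∧ M i ≤ m₀⁻¹ ∧ |a i| ≤ χ * M i
  /-- the pinned sound hypothesis leaf -/
  leaf : IsPinnedSoundNearKerrLeaf 𝒟.toCauchyDevelopment k' Λ 1 M a S
  /-- the probe point lies on the leaf -/ p_mem : p ∈ S
  /-- … and in the thick collar -/ p_mem_collar : ∃ i, p ∈ Φ i '' (B i).truncTimeSlab (3 * M i) 0
  /-- rest frame -/ restFrame : (mo 0).1 = 1
  /-- the thick-collar block (C1)–(C7) -/
  nearKerrCollarCore : 𝒟.NearKerrCollarCore k' δ γ 1 M a S p mo B Φ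
  /-- orientation clause on the shell -/ futureOriented : K2Route.CollarFutureOriented 𝒟 M mo B Φ
  /-- orientation clause on the slab -/ timeOriented : K2Route.CollarTimeOriented 𝒟 M a mo B Φ

-- the bundled data manifold carries its own instances (keyed on the projection `I.X`; overrides nothing)
attribute [instance] NearMinimisingInstance.topologicalSpace NearMinimisingInstance.chartedSpace
  NearMinimisingInstance.isManifold NearMinimisingInstance.t2Space
  NearMinimisingInstance.secondCountableTopology NearMinimisingInstance.connectedSpace

namespace NearMinimisingInstance

variable {χ m₀ : ℝ} {k' : ℕ} {Λ δ : ℝ≥0∞} {γ : ℝ}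

/-- The core `C = {p} ∪ Φ₀({t* = 0, M < r ≤ 3M})` of the instance. [folklore] -/
def core (I : NearMinimisingInstance χ m₀ k' Λ δ γ) : Set I.𝒟.carrier :=
  collarCore I.M I.p I.B I.Φ

/-- The instance's gap clause (C7) in the `BondiBartnikGapLE` form (definitional).
[cite: HuangLee2020, Def. 7.8] -/
theorem bondiBartnikGapLE (I : NearMinimisingInstance χ m₀ k' Λ δ γ) :
    I.𝒟.BondiBartnikGapLE I.core γ :=
  I.nearKerrCollarCore.2.2.2.2.2.2

end NearMinimisingInstance

/-- An instance of the **LIMIT CATEGORY with an EXACT, ORIENTED thick collar**: a maximal vacuum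
Cauchy development `𝒱` of arbitrary smooth data, one hole with `0 < M`, `|a| < M`, `p` in the thick
collar of a rest-frame chart `Φ₀` of the boosted Kerr star background (C1), smooth and an open
embedding on the collar layer (C2), with VANISHING `C^{k''}` deviation on the thick slab (C3,
`δ = 0`), core ON the Cauchy slice, and the orientation clauses — all hypotheses of
`ExactMinimiserKerrnessOriented` except the cut energy, the gap and the competitor. [folklore] -/
structure ExactCollarInstance (k'' : ℕ) : Type 1 where
  /-- the data manifold of the limit -/ X : Type
  /-- its topology -/ [topologicalSpace : TopologicalSpace X]
  /-- its charts -/ [chartedSpace : ChartedSpace E3 X]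
  /-- smoothness -/ [isManifold : IsManifold (𝓡 3) ∞ X]
  /-- Hausdorff -/ [t2Space : T2Space X]
  /-- second countable -/ [secondCountableTopology : SecondCountableTopology X]
  /-- connected -/ [connectedSpace : ConnectedSpace X]
  /-- the limit datum (arbitrary smooth data) -/ D : InitialDataSet (𝓡 3) X
  /-- its maximal vacuum development -/ 𝒱 : VacuumCauchyDevelopment D
  /-- mass of the hole -/ M : Fin 1 → ℝ
  /-- spin of the hole -/ a : Fin 1 → ℝ
  /-- the probe point -/ p : 𝒱.carrier
  /-- the motion of the collar chart -/ mo : Fin 1 → lorentzGroup × E4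
  /-- the background of the collar chart -/ B : Fin 1 → ModelBackground
  /-- the collar chart -/ Φ : ∀ i, (B i).domain → 𝒱.carrier
  /-- maximality -/ isMaximal : 𝒱.IsMaximal
  /-- sub-extremal parameters -/ params : ∀ i, 0 < M i ∧ |a i| < M i
  /-- the probe point lies in the thick collar -/
  p_mem_collar : ∃ i, p ∈ Φ i '' (B i).truncTimeSlab (3 * M i) 0
  /-- rest frame -/ restFrame : (mo 0).1 = 1
  /-- the core lies on the Cauchy slice -/ core_subset : collarCore M p B Φ ⊆ range 𝒱.embed
  /-- (C1) boosted Kerr star backgrounds -/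
  background : ∀ i, B i = starBackground (mo i).1 (mo i).2 (M i) (a i)
    (fun x => Kerr.radius (a i) (poincareInv (mo i).1 (mo i).2 x))
  /-- (C2) the chart is smooth on the collar layer and an open embedding of it -/
  chart : ∀ i, ContMDiffOn 𝓘(ℝ, E4) (𝓡 4) ∞ (Φ i)
      {x | -1 < (B i).time x.1 ∧ (B i).time x.1 < 1 ∧ (B i).radius x.1 < 3 * M i + 1} ∧
    IsOpenEmbedding
      ({x | -1 < (B i).time x.1 ∧ (B i).time x.1 < 1 ∧ (B i).radius x.1 < 3 * M i + 1}.restrict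
        (Φ i))
  /-- (C3, `δ = 0`) EXACT `k''`-jet of boosted Kerr on the thick slab -/
  exact : ∀ i, 𝒱.toSpacetime.truncDeviationCk (B i) (Φ i) k'' (3 * M i) 0 ≤ 0
  /-- orientation clause on the shell -/ futureOriented : K2Route.CollarFutureOriented 𝒱 M mo B Φ
  /-- orientation clause on the slab -/ timeOriented : K2Route.CollarTimeOriented 𝒱 M a mo B Φ

-- the bundled data manifold carries its own instances (keyed on the projection `L.X`; overrides nothing)
attribute [instance] ExactCollarInstance.topologicalSpace ExactCollarInstance.chartedSpace
  ExactCollarInstance.isManifold ExactCollarInstance.t2Space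
  ExactCollarInstance.secondCountableTopology ExactCollarInstance.connectedSpace

namespace ExactCollarInstance

variable {k'' : ℕ}

/-- The core of the limit instance. [folklore] -/
def core (L : ExactCollarInstance k'') : Set L.𝒱.carrier :=
  collarCore L.M L.p L.B L.Φ

/-- With a cut energy and gap `≤ 0` an exact collar instance carries the EXACT thick-collar block
`NearKerrCollarCore k'' 0 0 1 … univ …` ((C4) is trivial against `univ`, (C5) is vacuous for one
hole). [cite: HuangLee2020, Def. 7.8] -/
theorem nearKerrCollarCore (L : ExactCollarInstance k'')
    (hmass : ∃ m : ℝ, L.𝒱.toCauchyDevelopment.HasCutBondiMass L.core m)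
    (hgap : L.𝒱.BondiBartnikGapLE L.core 0) :
    L.𝒱.NearKerrCollarCore k'' 0 0 1 L.M L.a univ L.p L.mo L.B L.Φ :=
  ⟨L.background, L.chart, L.exact, fun _ ↦ subset_univ _,
    fun i j hij ↦ absurd (Subsingleton.elim i j) hij, hmass, hgap⟩

end ExactCollarInstance

/-- A **shadow** of the sequence `I` of near-minimising instances on the limit instance `L`: a
pointed `Cᵏ_loc` (Cheeger–Gromov) subconvergence `(𝒟_{sub n}, qₙ) ⇀ (𝒱, L.p)` of the developments
(`Spacetime.LocalSubconvergence`, Petersen 2006, Ch. 10 §3.2: exhaustion of the limit by precompact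
opens, comparison maps that are injective local diffeomorphisms preserving the time orientation,
`Cᵏ` convergence of the pulled-back metrics on compacta) based at FREE points `qₙ = base (sub n)`
(NOT the probe points: those may drift to the collar's inner edge), whose comparison maps carry the
limit core ONTO the approximants' cores, with converging hole parameters.  No covering clause: a
shadow does not pin `𝒱` to be the full limit. [cite: Petersen2006, Ch. 10 §3.2] -/
structure Shadow {χ m₀ : ℝ} {k' : ℕ} {Λ : ℝ≥0∞} {δ : ℕ → ℝ≥0∞} {γ : ℕ → ℝ}
    (I : ∀ n, NearMinimisingInstance χ m₀ k' Λ (δ n) (γ n)) {k'' : ℕ} (L : ExactCollarInstance k'')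
    (k : ℕ) where
  /-- the base points in the approximants -/ base : ∀ n, (I n).𝒟.carrier
  /-- the pointed `Cᵏ_loc` subconvergence `(𝒟ₙ, qₙ) ⇀ (𝒱, p)` -/
  cv : Spacetime.LocalSubconvergence (fun n ↦ (I n).𝒟.toSpacetime) base L.𝒱.toSpacetime L.p k
  /-- the comparison maps carry the limit core onto the cores of the approximants -/
  image_core : ∀ n, cv.embed n '' L.core = (I (cv.sub n)).core
  /-- the masses converge -/ tendsto_mass : Tendsto (fun n ↦ (I (cv.sub n)).M 0) atTop (𝓝 (L.M 0))
  /-- the spins converge -/ tendsto_spin : Tendsto (fun n ↦ (I (cv.sub n)).a 0) atTop (𝓝 (L.a 0))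

/-! ### The soft package as one statement -/

section Shadowing

variable {χ m₀ : ℝ} {k' : ℕ} {Λ δ : ℝ≥0∞} {γ : ℝ}

/-- The near-minimising instance `I` is **`(k₁, ε₁, R, T)`-shadowed**: some exact-collar instance
`L` of the limit category at a level `k'' ≥ 2` is an exact minimiser with a competitor (so that ALL
hypotheses of `ExactMinimiserKerrnessOriented` hold for it) and, if `L` has exact Kerr boxes of its
own background of EVERY order, radius and length inside `J⁺(C∞)` (the conclusion of
`ExactMinimiserKerrnessOriented`), then `I` has an `(ε₁, k₁)`-box of radius `R + 1` and length `T`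
of its collar's background inside `J⁺(C)`.  Route-posited notion; nothing is asserted.
[conjecture] [folklore] -/
def NearMinimisingInstance.IsShadowed (I : NearMinimisingInstance χ m₀ k' Λ δ γ) (k₁ : ℕ)
    (ε₁ : ℝ≥0∞) (R T : ℝ) : Prop :=
  ∃ (k'' : ℕ) (_ : 2 ≤ k'') (L : ExactCollarInstance k''),
    L.𝒱.NearKerrCollarCore k'' 0 0 1 L.M L.a univ L.p L.mo L.B L.Φ ∧
    (∃ m' : ℝ, L.𝒱.IsCompetitorMass L.core m') ∧
    ((∀ (K : ℕ) (R' T' : ℝ), ∃ (τ' : ℝ) (Ψ' : (L.B 0).domain → L.𝒱.carrier),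
        IsNearModelBox L.𝒱.toSpacetime (L.B 0) K 0 τ' (τ' + T') (L.M 0) (R' + 1)
          (L.𝒱.metric.causalFuture L.𝒱.timeOrientation L.core) Ψ') →
      ∃ (τ : ℝ) (Ψ : (I.B 0).domain → I.𝒟.carrier),
        IsNearModelBox I.𝒟.toSpacetime (I.B 0) k₁ ε₁ τ (τ + T) (I.M 0) (R + 1)
          (I.𝒟.metric.causalFuture I.𝒟.timeOrientation I.core) Ψ)

/-- **NEAR-MINIMISER SHADOWING** — all of K3's content beyond rigidity in one statement: for every
margin/window `(χ, m₀)`, box quality `(k₁, ε₁)`, radius `R` and length `T` there is `k'` such that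
below the honesty threshold some `δ, γ > 0` make every near-minimising instance
`(k₁, ε₁, R, T)`-shadowed.  The registered K3 is `NearMinimiserShadowing →
ExactMinimiserKerrnessOriented → K3` by pure logic (`stub_compactnessToKerrInterior_of_shadowing`),
and the reduction file derives it from (F1')–(F4) along a failing sequence.  OPEN (the planner's
"compactness–semicontinuity–transfer"); route-posited statement; nothing is asserted.
[conjecture] [folklore] -/
def NearMinimiserShadowing : Prop :=
  ∀ (χ m₀ : ℝ) (k₁ : ℕ) (ε₁ : ℝ≥0∞) (R T : ℝ), χ < 1 → 0 < m₀ → 0 < ε₁ →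
    ∃ k' : ℕ, ∀ Λ : ℝ≥0∞, Λ < 1 → ∃ (δ : ℝ≥0∞) (γ : ℝ), 0 < δ ∧ 0 < γ ∧
    ∀ I : NearMinimisingInstance χ m₀ k' Λ δ γ, I.IsShadowed k₁ ε₁ R T

end Shadowing

/-! ### The four missing facts (F1')–(F4), typed -/

section Facts

/-- **(F1') COMPACTNESS OF NEAR-MINIMISING SEQUENCES** (MISSING; all existence claims about the
limit).  For every margin/window and convergence order `k` there is `k'` (derivative loss) such that
below the honesty threshold every sequence of near-minimising instances with `δₙ, γₙ → 0` has a limit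
exact-collar instance `L` at level `k + 2` shadowing a subsequence in `Cᵏ_loc`, whose core HAS a cut
energy and HAS a competitor mass.  Route: Arzelà–Ascoli on the FIXED model layers of the pinned sound
leaf charts (collar, near zone, flat sheet — compact transition data by (S₆) and the window) gives a
limit leaf datum, exact Kerr on the slab (`δₙ → 0`), oriented (future-directedness is closed up to
sign and `dΦ` stays injective); its MGHD (`choquetBruhat_geroch_exists_mghd_cauchy`) has the core on
its slice; CAUCHY STABILITY on compacta (Ringström 2009, Ch. 16; Hawking–Ellis §7.5) and localisation of
MGHDs give the comparison maps, normalised to carry core onto core; cut energy of the limit: the limit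
outer roof must be complete with a Hawking limit (planner's risk (i): uniform control of the cone data
near `𝓘⁺`, flux norm only); competitor of the limit core: an admissible MGHD containing an isometric
copy of a neighbourhood of an exact thick Kerr collar (event-horizon / characteristic gluing,
Kehle–Unger 2024, Czimek–Rodnianski 2022, plus a vacuum cap inside `r ≤ M` — OPEN, the lead's Q1).
AUDIT: (R) as typed over the tree's SMOOTH `VacuumCauchyDevelopment` this also asserts that the limit is
smooth — Arzelà–Ascoli gives `C^{k'−1}` only; plausible solely through the minimisation itself
(persistent rough far-field content of positive removal cost is excluded by `γₙ → 0`); the faithful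
finite-regularity statement is not expressible in the tree.  Vacuous (hence true) if near-minimising
sequences do not exist (e.g. if exact Kerr collars are not Bondi–Bartnik minimisers, the lead's Q2).
Route-posited statement; nothing is asserted. [conjecture] [cite: RingstromCauchyProblem2009, Ch. 16] -/
def LeafCompactness' : Prop :=
  ∀ (χ m₀ : ℝ) (k : ℕ), χ < 1 → 0 < m₀ → ∃ k' : ℕ, ∀ Λ : ℝ≥0∞, Λ < 1 →
    ∀ (δ : ℕ → ℝ≥0∞) (γ : ℕ → ℝ), (∀ n, 0 < δ n) → Tendsto δ atTop (𝓝 0) →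
      (∀ n, 0 < γ n) → Tendsto γ atTop (𝓝 0) →
    ∀ I : ∀ n, NearMinimisingInstance χ m₀ k' Λ (δ n) (γ n),
      ∃ L : ExactCollarInstance (k + 2), Nonempty (Shadow I L k) ∧
        (∃ m : ℝ, L.𝒱.toCauchyDevelopment.HasCutBondiMass L.core m) ∧
        ∃ m' : ℝ, L.𝒱.IsCompetitorMass L.core m'

/-- **(F2) LOWER SEMICONTINUITY OF THE CUT ENERGY** (MISSING).  Along a shadow of order `k ≥ 2`, if
the limit core has a cut energy at all, then it has one, `m`, below every cut energy of the
approximants' cores up to `η`, eventually: `∀ η > 0, ∀ᶠ n, ∀ m', HasCutBondiMass Cₙ m' → m ≤ m' + η`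
(`m` = the rest-frame energy; `HasCutBondiMass` is frame-dependent by design, so "∃ m", not "∀ m").
Route: monotonicity of the Hawking mass along each roof `Nₙ` in a rest-frame round foliation
(Christodoulou–Klainerman 1993, Ch. 17; Sauter 2008, Thm 4.1; in the tree the flux identity is the
predicate `NullHypersurface.HasHawkingFlux`), `m_H(N∞ ∩ {s = s₀}) = limₙ m_H(Nₙ ∩ {s = s₀}) ≤ liminf
M_B(Cₙ)` at fixed affine level (roofs from matched cores are `C^{k−1}`-close on compacta before the
cut locus), then `s₀ → ∞`.  AUDIT: insensitive to small or partial limits (conditional on existence);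
trivially true along constant sequences; no symmetry of the hypotheses moves the conclusion (all
objects are time-oriented through the shadow).  Route-posited statement; nothing is asserted.
[conjecture] [cite: ChristodoulouKlainerman1993PMS41, Ch. 17, Conclusion 17.0.4] -/
def CutEnergyLSC : Prop :=
  ∀ (χ m₀ : ℝ) (k' : ℕ) (Λ : ℝ≥0∞) (δ : ℕ → ℝ≥0∞) (γ : ℕ → ℝ),
    Tendsto δ atTop (𝓝 0) → Tendsto γ atTop (𝓝 0) →
    ∀ (I : ∀ n, NearMinimisingInstance χ m₀ k' Λ (δ n) (γ n)) (k'' k : ℕ)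
      (L : ExactCollarInstance k'') (sh : Shadow I L k), 2 ≤ k →
    (∃ m₀' : ℝ, L.𝒱.toCauchyDevelopment.HasCutBondiMass L.core m₀') →
    ∃ m : ℝ, L.𝒱.toCauchyDevelopment.HasCutBondiMass L.core m ∧
      ∀ η : ℝ, 0 < η → ∀ᶠ n in atTop, ∀ m',
        (I (sh.cv.sub n)).𝒟.toCauchyDevelopment.HasCutBondiMass (I (sh.cv.sub n)).core m' →
          m ≤ m' + η

/-- **(F3) COMPETITOR REALISATION — upper semicontinuity of the infimum** (MISSING, XL).  Along a
shadow of order `k ≥ 2`, every competitor mass `m'` of the limit core is, for large `n`, within `η`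
of a competitor mass of the approximants' cores.  Route: a competitor `(𝒟', U, φ)` of the exact limit
core receives an isometric copy of a neighbourhood `U` of `C∞`; the approximants' neighbourhoods of
`Cₙ` are `Cᵏ`-close to `U` through the shadow (cores matched), and GLUING of vacuum data across an
annulus / along the roof (obstruction-free characteristic gluing, Czimek–Rodnianski arXiv:2210.09663,
Thm 1.1; Aretakis–Czimek–Rodnianski; Corvino–Schoen 2006 at the spacelike far end) transplants the
competitor's exterior onto the approximant's neighbourhood up to an `o(1)` change of the cut energy.
AUDIT: the existence of ONE competitor for the limit core is NOT claimed here (it is in (F1')), so the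
statement is insensitive to small limits and vacuous for competitor-free cores; trivially true along
constant sequences.  Route-posited statement; nothing is asserted.
[conjecture] [cite: CzimekRodnianski2022, Thm. 1.1] -/
def CompetitorRealisation : Prop :=
  ∀ (χ m₀ : ℝ) (k' : ℕ) (Λ : ℝ≥0∞) (δ : ℕ → ℝ≥0∞) (γ : ℕ → ℝ),
    Tendsto δ atTop (𝓝 0) → Tendsto γ atTop (𝓝 0) →
    ∀ (I : ∀ n, NearMinimisingInstance χ m₀ k' Λ (δ n) (γ n)) (k'' k : ℕ)
      (L : ExactCollarInstance k'') (sh : Shadow I L k), 2 ≤ k →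
    ∀ m', L.𝒱.IsCompetitorMass L.core m' → ∀ η : ℝ, 0 < η → ∀ᶠ n in atTop, ∃ m'',
      (I (sh.cv.sub n)).𝒟.IsCompetitorMass (I (sh.cv.sub n)).core m'' ∧ m'' ≤ m' + η

/-- **(F4) BOX TRANSFER — Cauchy stability of the compact box footprint, up to the spacelike inner
edge** (MISSING).  Along a shadow of order `k`, if the limit has EXACT Kerr boxes
`{τ' < t* < τ' + T', M∞ < r < R' + 1}` of its own background of every order, radius and length inside
`J⁺(C∞)`, then for `k₁ + 1 ≤ k`, `0 < ε` and every `R, T` the approximants have, for large `n`,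
`(ε, k₁)`-boxes of radius `R + 1` and length `T` of THEIR (rest-frame) backgrounds inside `J⁺(Cₙ)`.
Route: restrict one exact chart of size `(R + 2, T + 2)` to the middle sub-box (closure inside the
open big box, hence inside `I⁺(C∞)` by push-up — the causal MARGIN; `I⁺` is lower semicontinuous under
`C⁰` convergence on compacta and `embedₙ(C∞) = Cₙ`); compose with the comparison map and with the
translation ∘ `(M, a)`-stretch of coordinate boxes (`(Mₙ, aₙ) → (M∞, a∞)`; the box predicate is
covariant, frame drift harmless); `Cᵏ` convergence on the compact closure; the strip at the inner edge
`r → M⁺` (where the limit chart ends and `Mₙ < M∞` may occur) is controlled because `{r = M}` is a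
SPACELIKE exit boundary inside the black hole for `|a| < M` (`r₋ < M`): the limit MGHD is Kerr slightly
below `r = M∞` at late times and energy estimates close without boundary data (Ringström 2009, Ch. 16;
the no-shift region of Dafermos–Luk 2017, §1).  AUDIT: degenerate boxes (`T ≤ 0` or `R + 1 ≤ Mₙ`) are
free; vacuous for limits without boxes; trivially true along constant sequences (`ε > 0`); oriented
throughout.  Route-posited statement; nothing is asserted.
[conjecture] [cite: RingstromCauchyProblem2009, Ch. 16] -/
def BoxTransfer : Prop :=
  ∀ (χ m₀ : ℝ) (k' : ℕ) (Λ : ℝ≥0∞) (δ : ℕ → ℝ≥0∞) (γ : ℕ → ℝ),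
    Tendsto δ atTop (𝓝 0) → Tendsto γ atTop (𝓝 0) →
    ∀ (I : ∀ n, NearMinimisingInstance χ m₀ k' Λ (δ n) (γ n)) (k'' k : ℕ)
      (L : ExactCollarInstance k'') (sh : Shadow I L k) (k₁ : ℕ) (ε : ℝ≥0∞) (R T : ℝ),
      k₁ + 1 ≤ k → 0 < ε →
    (∀ (K : ℕ) (R' T' : ℝ), ∃ (τ' : ℝ) (Ψ' : (L.B 0).domain → L.𝒱.carrier),
      IsNearModelBox L.𝒱.toSpacetime (L.B 0) K 0 τ' (τ' + T') (L.M 0) (R' + 1)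
        (L.𝒱.metric.causalFuture L.𝒱.timeOrientation L.core) Ψ') →
    ∀ᶠ n in atTop, ∃ (τ : ℝ) (Ψ : ((I (sh.cv.sub n)).B 0).domain → (I (sh.cv.sub n)).𝒟.carrier),
      IsNearModelBox (I (sh.cv.sub n)).𝒟.toSpacetime ((I (sh.cv.sub n)).B 0) k₁ ε τ (τ + T)
        ((I (sh.cv.sub n)).M 0) (R + 1)
        ((I (sh.cv.sub n)).𝒟.metric.causalFuture (I (sh.cv.sub n)).𝒟.timeOrientation
          (I (sh.cv.sub n)).core) Ψ

end Facts

end K3Route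

/-! ### The registered K3 from the soft package and exact-minimiser Kerrness, by pure logic -/

/-- **K3 from `K3Route.NearMinimiserShadowing` and `ExactMinimiserKerrnessOriented` by pure logic**
(the anchor of this statement file, registered as `stub_compactnessToKerrInterior_of_shadowing`):
bundle the registered hypotheses into a `K3Route.NearMinimisingInstance`; the shadowing exact minimiser
satisfies the hypotheses of `ExactMinimiserKerrnessOriented`, which yields exact boxes of every size
inside its `J⁺(C∞)`; the transfer clause turns them into the `(ε₁, k₁)`-box.  The conclusion after the
two antecedents is VERBATIM the registered signature of `stub_compactnessToKerrInterior`. [folklore] -/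
theorem stub_compactnessToKerrInterior_of_shadowing : K3Route.NearMinimiserShadowing → ExactMinimiserKerrnessOriented → ∀ (χ m₀ : ℝ) (k₁ : ℕ) (ε₁ : ℝ≥0∞) (R T : ℝ), χ < 1 → 0 < m₀ → 0 < ε₁ → ∃ k' : ℕ, ∀ Λ : ℝ≥0∞, Λ < 1 → ∃ (δ : ℝ≥0∞) (γ : ℝ), 0 < δ ∧ 0 < γ ∧ ∀ (X : Type) [TopologicalSpace X] [ChartedSpace E3 X] [IsManifold (𝓡 3) ∞ X] [T2Space X] [SecondCountableTopology X] [ConnectedSpace X], ∀ D ∈ admissibleVacuumData X, ∀ (𝒟 : VacuumCauchyDevelopment D) (M a : Fin 1 → ℝ) (S : Set 𝒟.carrier) (p : 𝒟.carrier) (mo : Fin 1 → lorentzGroup × E4) (B : Fin 1 → ModelBackground) (Φ : ∀ i, (B i).domain → 𝒟.carrier), 𝒟.IsMaximal → (∀ i, m₀ ≤ M i ∧ M i ≤ m₀⁻¹ ∧ |a i| ≤ χ * M i) → IsPinnedSoundNearKerrLeaf 𝒟.toCauchyDevelopment k' Λ 1 M a S → p ∈ S → (∃ i, p ∈ Φ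 i '' (B i).truncTimeSlab (3 * M i) 0) → (mo 0).1 = 1 → 𝒟.NearKerrCollarCore k' δ γ 1 M a S p mo B Φ → K2Route.CollarFutureOriented 𝒟 M mo B Φ → K2Route.CollarTimeOriented 𝒟 M a mo B Φ → ∃ (τ : ℝ) (Ψ : (B 0).domain → 𝒟.carrier), IsNearModelBox 𝒟.toSpacetime (B 0) k₁ ε₁ τ (τ + T) (M 0) (R + 1) (𝒟.metric.causalFuture 𝒟.timeOrientation (collarCore M p B Φ)) Ψ := by
  intro hS hE χ m₀ k₁ ε₁ R T hχ hm₀ hε₁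
  obtain ⟨k', hk'⟩ := hS χ m₀ k₁ ε₁ R T hχ hm₀ hε₁
  refine ⟨k', fun Λ hΛ ↦ ?_⟩
  obtain ⟨δ, γ, hδ, hγ, h⟩ := hk' Λ hΛ
  refine ⟨δ, γ, hδ, hγ, ?_⟩
  intro X _ _ _ _ _ _ D hD 𝒟 M a S p mo B Φ hmax hwin hleaf hp hpc hrest hcore hfut htime
  obtain ⟨k'', hk'', L, hcore', hcomp', htransfer⟩ :=
    h ⟨X, D, hD, 𝒟, M, a, S, p, mo, B, Φ, hmax, hwin, hleaf, hp, hpc, hrest, hcore, hfut, htime⟩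
  exact htransfer (hE k'' hk'' L.X L.D L.𝒱 L.M L.a L.p L.mo L.B L.Φ L.isMaximal L.params
    L.p_mem_collar L.core_subset hcore' L.futureOriented L.timeOriented hcomp')

end Summit.FinalStateConjecture.FinalStateConjecture.Theorems.BondiBartnikRigidity.DirectMethod

end
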